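import Summits.BirchSwinnertonDyer.Rank1Residual.X2.GreenbergVatsalCaseTwoLe
import Summits.BirchSwinnertonDyer.Rank1Residual.X2.ClassClosureEntireFree
import HarnessLib

/-!
# The X2a closure of record WITHOUT the datum record T-GV23L and WITHOUT A137′: A64, A63, Mazur's
# main conjecture per GV-parity pair and `X2.TargetA` from THIRTEEN registered facts — cell
# `b2b-bsdres`, unit `b2b-bsdres-eisenstein-p2`, gen 30 (F7e)

HONEST FRAMING (run/shared/lean/b2b/bsd-rank1-residual/, verbatim in every file): the goal of the
cell is to DELETE the COMBINATION-SHAPED residual classes of the Birch–Swinnerton-Dyer formula for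
ALL analytic-rank `≤ 1` elliptic curves over `ℚ` — "full BSD formula for every rank `≤ 1` curve in
class `C`" assembled STRICTLY from published theorems — so that the rank-`≤ 1` remainder becomes
exactly the CONSTRUCTION-SHAPED classes, which are TYPED (missing-input `Prop`s), NOT attempted.
This is not "finishing BSD". Research route; NO CLAIM BEYOND STATED CLASSES; nothing here changes a
label. Theorems only; no definition, no named fact, no `sorry`.

WHAT. The X2a closing form of record (gen 29: `ClassClosureEntireFree.targetA_entireFree_heightFree`,
FIFTEEN registered-fact binders) binds the datum record T-GV23L (`h23 :
datumSelmer_nonPrimitive_invariants`, Greenberg–Vatsal Cor. (2.3)/Prop. (2.4) for a general Selmer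
datum: `λ(S^{Σ₀}_A) = λ(S_A) + Σδ_A`) and A137′ (`hInf : datumStrictSelmer_relIndex_eq_zero_of_split`,
infinitude of the trivial-zero quotient). Both served ONLY the algebraic EQUALITY
`#H¹(Φ₀)·#S^{Σ₀}_ψ = p^{λ(X)+Σδ+e}` of GV (16). Gen 30 proved its upper half `≤` in the kernel from
A40/A41/A135 (local Tate-datum cohomology at the bad places, corank subadditivity,
`S_A/S^{str} ↪ S^{Σ₀}_A/S^{Σ₀,str}`; files `NonPrimitiveLambdaShift*`, `NonPrimitiveLambdaLe*`,
`GreenbergSelmerCountLe`, `GreenbergVatsalAnalyticTransferLe`) and observed that the lower half is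
Wuthrich 2014 Thm. 16 (A33 `hWu`, already a binder; `GreenbergVatsalCaseOneLe`). Hence:

* **`lambda_muAnal_multiplicative_of_gvPar_datumFree`** — A64 from EIGHT registered facts {A40 `hT`,
  A41 `hT'`, A135 `hB`, A195 `hLiftF`, A226 `h311`, A224 `hC`, A225 `hD`, A33 `hWu`} (gen 28: nine,
  with `h23`, `hInf` and without `hWu`);
* **`lambdaMu_multiplicative_of_gvPar_datumFree`** — A63 from the same eight;
* `mazurMainConjectureAt_of_gvPar_datumFree` — Mazur's main conjecture at every odd multiplicative
  pair of GV parity, from the eight;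
* **`targetA_datumFree : X2.TargetA` from THIRTEEN registered facts** {A40, A41, A135, A195, A226,
  A224, A225, A33, Stein–Wuthrich Thm. 6.1 `hJs`/`hJn`, `hGZK`, `hpar`, `hGS`} — the X2a closure of
  record, T-GV23L and A137′ DISCHARGED;
* `target_datumFree_of_residues`, `bsdp_of_classX2_of_gvPar_datumFree` — the class theorem modulo
  the named X2b/X2c residues and `BSD(E,p)` per GV-parity pair, likewise without `h23`/`hInf`.

References: [GreenbergVatsal2000] Thm. (1.3), §1 (5)–(9), pp. 14–16, §2 (16), Cor. (2.3), Prop. (2.4),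
pp. 20, 25–30, §3 Thm. (3.11), (26)–(28), pp. 41–43; [Wuthrich2014] Thm. 16 (p. 397);
[GreenbergLNM1716] Prop. 5.10; [SteinWuthrich2013] Thm. 6.1, §4.2; [BCDTJAMS2001] Thm. A;
[Disegni2020] Thm. 4; HOME/b2b-bsdres-eisenstein-p2/X2-GAP.md §35.
-/

set_option autoImplicit false

noncomputable section

open scoped Classical AddSubgroup MatrixGroups ModularForm

open PowerSeries NumberField IsDedekindDomain Field WeierstrassCurve CongruenceSubgroup
  Literature.NumberTheory.EllipticCurves Literature.NumberTheory.EllipticCurves.GreenbergVatsal2000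
  Literature.NumberTheory.EllipticCurves.ModularForms
  Literature.NumberTheory.EllipticCurves.Rank1Residual
  Literature.NumberTheory.EllipticCurves.Rank1Residual.Typed
  Literature.NumberTheory.EllipticCurves.Greenberg1999
  Literature.NumberTheory.EllipticCurves.Wuthrich2014
  Literature.NumberTheory.EllipticCurves.SteinWuthrich2013
  Literature.NumberTheory.EllipticCurves.Disegni2020
  Summit.BirchSwinnertonDyer.Rank1Residual.X2.GreenbergVatsalInputsOfFacts
  Summit.BirchSwinnertonDyer.Rank1Residual.X2.EisensteinCongruenceOfFacts
  Summit.BirchSwinnertonDyer.Rank1Residual.X2.GreenbergProp510OfFacts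
  Summit.BirchSwinnertonDyer.Rank1Residual.X2.ClassClosureOfDerivedF0
  Summit.BirchSwinnertonDyer.Rank1Residual.X2.GreenbergVatsalCaseTwoPeriodFree
  Summit.BirchSwinnertonDyer.Rank1Residual.X2.GreenbergVatsalCaseTwoLe
  Summit.BirchSwinnertonDyer.Rank1Residual.X2.ClassClosurePeriodFree
  Summit.BirchSwinnertonDyer.Rank1Residual.X2.ClassClosureEntireFree

namespace Summit.BirchSwinnertonDyer.Rank1Residual.X2.ClassClosureDatumFree

/-! ## §1. A64 and A63 from eight registered facts -/

/-- **A64 (`lambda_muAnal_multiplicative_of_gvPar`) from EIGHT registered facts** {A40 `hT`, A41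
`hT'`, A135 `hB`, A195 `hLiftF`, A226 `h311`, A224 `hC`, A225 `hD`, A33 `hWu`}: gen 28's suppliers
(`prop510_isTorsion_hasUnitContent_of_gvPar_of_facts`, `gvLiftingInput_of_fact`,
`gvAnalyticInput_of_fact ∘ nonPrimitive_unitContent_and_lambda_eq_residual_of_lineRamifiedEven_of_facts`,
`exists_characterLFunction_holds`) fed into gen 30's `lambda_muAnal_multiplicative_of_gvPar_of_inputs_le`.
NOT used: T-GV23L, A137′ (nor A133, A137).
[cite: GreenbergVatsal2000, Thm. (1.3), §1 pp. 14–15, §2 (16), Prop. (2.1), pp. 28–30, §3 Thm. (3.11), (28), pp. 41–43]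
[cite: Wuthrich2014, Thm. 16 (p. 397)] -/
theorem lambda_muAnal_multiplicative_of_gvPar_datumFree
    (hT : Silverman1994_thmV53_tateUniformisation.{0})
    (hT' : Silverman1994_thmV53_corV54_tateUniformisation.{0})
    (hB : datumSelmer_divisible_of_finite_torsionBy)
    (hLiftF : residualEpsilon_surjOn_of_lineRamifiedEven)
    (h311 : thm311_hasUnitContent_iff_and_order_eq_of_lineRamifiedEven)
    (hC : characterLFunctionC_hasUnitContent_and_order_eq_card)
    (hD : characterLFunctionD_hasUnitContent_and_order_eq_card)
    (hWu : thm16_charIdeal_dvd_multiplicative_of_reducible) :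
    lambda_muAnal_multiplicative_of_gvPar :=
  lambda_muAnal_multiplicative_of_gvPar_of_inputs_le hT hT' hB
    (prop510_isTorsion_hasUnitContent_of_gvPar_of_facts hT hT' exists_characterLFunction_holds hC hD)
    hWu
    (fun W _ _ p _ κ S₀ Φ₀ hΦ hp hκ hram heven hS₀ hS ↦
      gvLiftingInput_of_fact hLiftF W p κ S₀ Φ₀ hΦ hp hκ hram heven hS₀ hS)
    (fun W _ _ p _ κ _ _ f S₀ Φ₀ hΦ hp hmult hκ hram heven hf hS₀ hS ↦
      gvAnalyticInput_of_fact
        (nonPrimitive_unitContent_and_lambda_eq_residual_of_lineRamifiedEven_of_facts hT hT'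
          exists_characterLFunction_holds h311 hC hD)
        W p κ f S₀ Φ₀ hΦ hp hmult hκ hram heven hf hS₀ hS)

/-- **A63 (`lambdaMu_multiplicative_of_gvPar`) from the same EIGHT registered facts**, by the tree's
`lambdaMu_multiplicative_of_gvPar_of_parts` (Wuthrich Thm. 16 + Greenberg Prop. 5.10 + A64).
[cite: GreenbergVatsal2000, Thm. (1.3), §2 (16), pp. 28–30, §3 Thm. (3.11)]
[cite: Wuthrich2014, Thm. 16 (p. 397)] [cite: GreenbergLNM1716, Prop. 5.10 (PDF p. 147)] -/
theorem lambdaMu_multiplicative_of_gvPar_datumFree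
    (hT : Silverman1994_thmV53_tateUniformisation.{0})
    (hT' : Silverman1994_thmV53_corV54_tateUniformisation.{0})
    (hB : datumSelmer_divisible_of_finite_torsionBy)
    (hLiftF : residualEpsilon_surjOn_of_lineRamifiedEven)
    (h311 : thm311_hasUnitContent_iff_and_order_eq_of_lineRamifiedEven)
    (hC : characterLFunctionC_hasUnitContent_and_order_eq_card)
    (hD : characterLFunctionD_hasUnitContent_and_order_eq_card)
    (hWu : thm16_charIdeal_dvd_multiplicative_of_reducible) :
    lambdaMu_multiplicative_of_gvPar :=
  lambdaMu_multiplicative_of_gvPar_of_parts hWu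
    (prop510_isTorsion_hasUnitContent_of_gvPar_of_facts hT hT' exists_characterLFunction_holds hC hD)
    (lambda_muAnal_multiplicative_of_gvPar_datumFree hT hT' hB hLiftF h311 hC hD hWu)

/-! ## §2. The X2a closure terms without the datum record -/

/-- **Mazur's main conjecture at every odd multiplicative pair of GV parity from EIGHT registered
facts** (gen 28: ten). [cite: GreenbergVatsal2000, Thm. (1.3) with §1 pp. 14–15, §2 pp. 28–30, §3 Thm. (3.11)]
[cite: Wuthrich2014, Thm. 16 (p. 397)] -/
theorem mazurMainConjectureAt_of_gvPar_datumFree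
    (hT : Silverman1994_thmV53_tateUniformisation.{0})
    (hT' : Silverman1994_thmV53_corV54_tateUniformisation.{0})
    (hB : datumSelmer_divisible_of_finite_torsionBy)
    (hLiftF : residualEpsilon_surjOn_of_lineRamifiedEven)
    (h311 : thm311_hasUnitContent_iff_and_order_eq_of_lineRamifiedEven)
    (hC : characterLFunctionC_hasUnitContent_and_order_eq_card)
    (hD : characterLFunctionD_hasUnitContent_and_order_eq_card)
    (hWu : thm16_charIdeal_dvd_multiplicative_of_reducible)
    (W : WeierstrassCurve ℚ) [W.IsElliptic] [W.IsGloballyMinimal] (p : ℕ) [Fact p.Prime]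
    (hp : p ≠ 2) (hmult : W.HasMultiplicativeReductionAtPrime p) (hgv : GVPar W p) :
    MazurMainConjectureAt W p :=
  X2.mazurMainConjectureAt_of_gvPar
    (lambdaMu_multiplicative_of_gvPar_datumFree hT hT' hB hLiftF h311 hC hD hWu) hWu W p hp hmult hgv

/-- **`X2.TargetA` (the X2a closure of record: `BSD(E,p)` at every pair with `r_an = 0`, `p` odd
multiplicative, GV parity) from THIRTEEN registered facts** — gen 29's
`targetA_entireFree_heightFree` (fifteen) with T-GV23L (`h23`) and A137′ (`hInf`) DISCHARGED.
Registered inputs: A40/A41 `hT`/`hT'` · A135 `hB` · A195 `hLiftF` · A226 `h311` · A224/A225 `hC`/`hD`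
· A33 `hWu` · Stein–Wuthrich Thm. 6.1 `hJs`/`hJn` · `hGZK` · `hpar` · `hGS`.
[cite: GreenbergVatsal2000, Thm. (1.3) with pp. 1, 14–15, §2 pp. 28–30, §3 Thm. (3.11), pp. 41–43]
[cite: Wuthrich2014, Thm. 16 (p. 397)] [cite: SteinWuthrich2013, Thm. 6.1 (p. 20), §4.2]
[cite: BCDTJAMS2001, Theorem A] -/
theorem targetA_datumFree
    (hT : Silverman1994_thmV53_tateUniformisation.{0})
    (hT' : Silverman1994_thmV53_corV54_tateUniformisation.{0})
    (hB : datumSelmer_divisible_of_finite_torsionBy)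
    (hLiftF : residualEpsilon_surjOn_of_lineRamifiedEven)
    (h311 : thm311_hasUnitContent_iff_and_order_eq_of_lineRamifiedEven)
    (hC : characterLFunctionC_hasUnitContent_and_order_eq_card)
    (hD : characterLFunctionD_hasUnitContent_and_order_eq_card)
    (hWu : thm16_charIdeal_dvd_multiplicative_of_reducible)
    (hJs : thm61_splitMultiplicative) (hJn : thm61_nonsplitMultiplicative)
    (hGZK : rank_eq_analyticRank_of_analyticRank_le_one)
    (hpar : nonempty_modularParametrizationData)
    (hGS : ∀ (W : WeierstrassCurve ℚ) [W.IsElliptic] [W.IsGloballyMinimal] (p : ℕ) [Fact p.Prime],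
      greenberg_stevens (W := W) (p := p)) :
    TargetA :=
  X2.targetA_of_published_heightFree
    (lambdaMu_multiplicative_of_gvPar_datumFree hT hT' hB hLiftF h311 hC hD hWu) hWu hJs hJn hGZK
    (ClassClosureEntireFree.hasEntireLFunction_rat_of_nonempty_modularParametrizationData hpar) hpar hGS

/-- **THE CLASS THEOREM OF RECORD MODULO NAMED RESIDUES, without the datum record** — gen 29's
`ClassClosureEntireFree.target_entireFree_of_residues` with T-GV23L `h23` and A137′ `hInf`
DISCHARGED; class-level registered inputs A40/A41 `hT`/`hT'`, A135 `hB`, A195 `hLiftF`, A226 `h311`,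
A224/A225 `hC`/`hD`, A33 `hWu` + the rank-`≤ 1` assembly facts; per-pair residues exactly as before
(`hResB`, `hResCns`, `hResCs`). [cite: GreenbergVatsal2000, Thm. (1.3), §1 pp. 14–15, §2 pp. 28–30, §3 Thm. (3.11), (26)–(28), pp. 41–43]
[cite: Wuthrich2014, Thm. 16 (p. 397)] [cite: Disegni2020, Thm. 4 (§3.2)]
[cite: SteinWuthrich2013, Thm. 6.1 (p. 20) and §4.2] [cite: BCDTJAMS2001, Theorem A] -/
theorem target_datumFree_of_residues
    (hT : Silverman1994_thmV53_tateUniformisation.{0})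
    (hT' : Silverman1994_thmV53_corV54_tateUniformisation.{0})
    (hB : datumSelmer_divisible_of_finite_torsionBy)
    (hLiftF : residualEpsilon_surjOn_of_lineRamifiedEven)
    (h311 : thm311_hasUnitContent_iff_and_order_eq_of_lineRamifiedEven)
    (hC : characterLFunctionC_hasUnitContent_and_order_eq_card)
    (hD : characterLFunctionD_hasUnitContent_and_order_eq_card)
    (hWu : thm16_charIdeal_dvd_multiplicative_of_reducible)
    (hJs : thm61_splitMultiplicative) (hJn : thm61_nonsplitMultiplicative)
    (hHs : exists_isSplitMultCanonical) (hHn : exists_isMultCanonical)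
    (hGZ : GrossZagier1986_thm_I_7_3) (hGZK : rank_eq_analyticRank_of_analyticRank_le_one)
    (hpar : nonempty_modularParametrizationData)
    (hGS : ∀ (W : WeierstrassCurve ℚ) [W.IsElliptic] [W.IsGloballyMinimal] (p : ℕ) [Fact p.Prime],
      greenberg_stevens (W := W) (p := p))
    (hDis : padicBSD_rankOne_nonsplitMult)
    (hResB : ∀ (W : WeierstrassCurve ℚ) [W.IsElliptic] [W.IsGloballyMinimal] (p : ℕ) [Fact p.Prime],
      CellB W p → MazurMainConjectureAt W p)
    (hResCns : ∀ (W : WeierstrassCurve ℚ) [W.IsElliptic] [W.IsGloballyMinimal] (p : ℕ) [Fact p.Prime],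
      CellC W p → ¬ W.HasSplitMultiplicativeReductionAtPrime p →
        (GVPar W p ∨ MazurMainConjectureAt W p) ∧
        ∀ (q : ℚ_[p]) (Dh : PAdicHeightData W p), q ≠ 0 → ‖q‖ < 1 → tateJ q = (W.j : ℚ_[p]) →
          IsMultCanonical Dh q → SchneiderConjecture Dh)
    (hResCs : ∀ (W : WeierstrassCurve ℚ) [W.IsElliptic] [W.IsGloballyMinimal] (p : ℕ) [Fact p.Prime],
      CellC W p → W.HasSplitMultiplicativeReductionAtPrime p →
        (GVPar W p ∨ MazurMainConjectureAt W p) ∧ O9.ExceptionalLeadingTermAt W p ∧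
        ∀ (Dq : TateParameterData W p) (Dh : PAdicHeightData W p),
          IsSplitMultCanonical Dh Dq → SchneiderConjecture Dh) :
    Target := by
  have hGV : lambdaMu_multiplicative_of_gvPar :=
    lambdaMu_multiplicative_of_gvPar_datumFree hT hT' hB hLiftF h311 hC hD hWu
  have hmod : hasEntireLFunction_rat :=
    ClassClosureEntireFree.hasEntireLFunction_rat_of_nonempty_modularParametrizationData hpar
  refine target_of_targets (targetA_of_published hGV hWu hJs hJn hHs hHn hGZK hmod hpar hGS)
    (targetB_of_missingInputB hJs hJn hHs hHn hGZK hmod hpar hGS hResB) ?_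
  intro W _ _ p _ hc
  by_cases hsplit : W.HasSplitMultiplicativeReductionAtPrime p
  · obtain ⟨hMC, hExc, hSch⟩ := hResCs W p hc hsplit
    have hMC' : MazurMainConjectureAt W p := by
      rcases hMC with hgv | hMC
      · exact mazurMainConjectureAt_of_gvPar hGV hWu W p hc.2.1 hc.2.2.2 hgv
      · exact hMC
    exact bsdp_of_cellC_of_split_of_mazurMainConjectureAt_of_exceptionalLeadingTerm W p hJs hHs hGZ
      hGZK hpar hc hsplit hMC' hExc hSch
  · obtain ⟨hMC, hSch⟩ := hResCns W p hc hsplit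
    exact bsdp_of_cellC_of_not_split_of_gvPar_or_mazurMainConjectureAt_of_schneider W p hDis hGV hWu
      hJn hHn hGZ hGZK hpar hc hsplit hMC hSch

/-- **X2 WITHOUT residues on its GV-parity part, without the datum record**: on every X2 pair with
`GVPar`, `BSD(E,p)` holds at `r_an = 0` outright and at `r_an = 1` modulo the Schneider certificate
(non-split) / the certificate and the typed exceptional leading term (split) — gen 29's
`bsdp_of_classX2_of_gvPar_entireFree` with `h23`/`hInf` discharged.
[cite: GreenbergVatsal2000, Thm. (1.3) with §2 pp. 28–30, §3 Thm. (3.11)]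
[cite: Disegni2020, Thm. 4 (§3.2)] [cite: Wuthrich2014, Thm. 16 (p. 397)]
[cite: BCDTJAMS2001, Theorem A] -/
theorem bsdp_of_classX2_of_gvPar_datumFree
    (hT : Silverman1994_thmV53_tateUniformisation.{0})
    (hT' : Silverman1994_thmV53_corV54_tateUniformisation.{0})
    (hB : datumSelmer_divisible_of_finite_torsionBy)
    (hLiftF : residualEpsilon_surjOn_of_lineRamifiedEven)
    (h311 : thm311_hasUnitContent_iff_and_order_eq_of_lineRamifiedEven)
    (hC : characterLFunctionC_hasUnitContent_and_order_eq_card)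
    (hD : characterLFunctionD_hasUnitContent_and_order_eq_card)
    (hWu : thm16_charIdeal_dvd_multiplicative_of_reducible)
    (hJs : thm61_splitMultiplicative) (hJn : thm61_nonsplitMultiplicative)
    (hHs : exists_isSplitMultCanonical) (hHn : exists_isMultCanonical)
    (hGZ : GrossZagier1986_thm_I_7_3) (hGZK : rank_eq_analyticRank_of_analyticRank_le_one)
    (hpar : nonempty_modularParametrizationData)
    (W : WeierstrassCurve ℚ) [W.IsElliptic] [W.IsGloballyMinimal] (p : ℕ) [Fact p.Prime]
    (hGS : greenberg_stevens (W := W) (p := p)) (hDis : padicBSD_rankOne_nonsplitMult)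
    (hr : W.analyticRank ≤ 1) (hX : ClassX2 W p) (hgv : GVPar W p)
    (hSchNs : W.analyticRank = 1 → ¬ W.HasSplitMultiplicativeReductionAtPrime p →
      ∀ (q : ℚ_[p]) (Dh : PAdicHeightData W p), q ≠ 0 → ‖q‖ < 1 → tateJ q = (W.j : ℚ_[p]) →
        IsMultCanonical Dh q → SchneiderConjecture Dh)
    (hExcS : W.analyticRank = 1 → W.HasSplitMultiplicativeReductionAtPrime p →
      O9.ExceptionalLeadingTermAt W p ∧
      ∀ (Dq : TateParameterData W p) (Dh : PAdicHeightData W p),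
        IsSplitMultCanonical Dh Dq → SchneiderConjecture Dh) :
    BSDp W p := by
  have hGV : lambdaMu_multiplicative_of_gvPar :=
    lambdaMu_multiplicative_of_gvPar_datumFree hT hT' hB hLiftF h311 hC hD hWu
  have hmod : hasEntireLFunction_rat :=
    ClassClosureEntireFree.hasEntireLFunction_rat_of_nonempty_modularParametrizationData hpar
  rcases Nat.le_one_iff_eq_zero_or_eq_one.mp hr with h0 | h1
  · exact bsdp_of_classX2_of_gvPar_of_analyticRank_eq_zero hGV hWu hJs hJn hHs hHn hGZK hmod hpar W p
      hGS h0 hX hgv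
  · have hc : CellC W p := ⟨h1, hX⟩
    by_cases hsplit : W.HasSplitMultiplicativeReductionAtPrime p
    · obtain ⟨hExc, hSch⟩ := hExcS h1 hsplit
      exact bsdp_of_cellC_of_split_of_gvPar_of_exceptionalLeadingTerm W p hGV hWu hJs hHs hGZ hGZK hpar
        ⟨hc, hsplit, hgv⟩ hExc hSch
    · exact bsdp_of_cellC_of_not_split_of_gvPar_of_schneider W p hDis hGV hWu hJn hHn hGZ hGZK hpar
        ⟨hc, hsplit, hgv⟩ (hSchNs h1 hsplit)

end Summit.BirchSwinnertonDyer.Rank1Residual.X2.ClassClosureDatumFree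

end
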